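import Summits.QuantumFields.YangMills.Theorems.VirialFluxGapFixHaarIBP
import Summits.QuantumFields.YangMills.Theorems.VirialFluxGapPeriodicSoftnessOfEulerField
import HarnessLib

/-!
# Route `VirialFluxGap` (YangMills): `PeriodicSoftness` from an Euler field IN TREE GAUGE — w3 g58's virial ∕ IBP reduction transferred to the
# reduced product group `X_fix = SU(2)^{off-tree} × (slices 1…2L−1) × (seam)`

✓`EulerFieldReduction.periodicSoftness_of_eulerField` (w3 g58) reduces the deciding crux ⟨stmt-QuantumFields-24141⟩ to an Euler-type
coefficient field on the FULL ring space `Ω_L`, where the `3L³` gauge directions must carry weight `0` in the divergence budget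
`18L⁴ − 2c₁` (the per-variable radial profile alone has divergence `18L⁴ + 3L³`).  By ✓`TreeGaugeTransfer.gibbsMean_eq_fix` ∕
`measureReal_deficit_le_eq_fix` the Gibbs mean and the volume floor live equally well on the reduced product group
`X_fix = (OffIdx L → SU2) × ((Fin (2L−1) → GaugeConfig 3 L SU2) × (Site 3 L → SU2))` with product Haar and reduced deficit
`F_fix(w, r) = F₀(glue w ∷ r)` (slice `0` in comb gauge), whose only residual symmetry is the constant `SU(2)` and whose valley is the
explicit 6-parameter comb family (✓`RegularValley.ringDeficit_eq_zero_iff_comb`); the engine on `X_fix` is ✓`VirialFluxGapFixHaarIBP`.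

★★★ `periodicSoftness_of_eulerFieldFix : «EulerFieldFix» → Theses.VirialFluxGap.PeriodicSoftness` BY NAME — «EulerFieldFix» is w3's
«EulerField» VERBATIM with `Ω_L`, `F₀` replaced by `X_fix`, `F_fix` (curves `γ_j : ℝ → X_fix` with `γ_j 0 = 1`, coefficients, derivatives,
error term, `(i) Σφ_j·DF_j ≥ 2(1−ε)F_fix − E`, `(ii) Σ Dφ_j ≤ 18L⁴ − 2c₁`); softness `c₁/2`, window of ✓`stub_windowArithmeticZero K q 1`
(assembly = w3's `tail_le` ∕ `mean_le_of_virial`, with ✓`gibbsMean_eq_fix` inserted before ✓`deficitFormZero`).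

HONEST FRAMING: a REDUCTION; the Euler field on `X_fix` is NOT constructed; ⟨24141⟩ stays OPEN; the Yang–Mills mass gap is NOT proved; no
summit is proved by a line.  THEOREMS ONLY (0 `def`, 0 `sorry`), standard axioms.  Width seat `ym-line-sfw-p2-w2` g51 (cell ym-idea-1, free
hands), `--supports stmt-QuantumFields-24141`.  References: [cite: Griffiths1964]; [cite: SeilerLNP1982, §2]; [cite: Luscher1983, §2].
-/

set_option autoImplicit false

noncomputable section

open MeasureTheory Set Filter Metric
open scoped Topology BigOperators
open Literature.MathematicalPhysics.QuantumFieldTheory hiding SU2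
open Literature.MathematicalPhysics.QuantumLattice

namespace Summit.QuantumFields.YangMills.Theorems.VirialFluxGap.TreeGaugeTransfer

open Summit.QuantumFields.YangMills.Theorems.FemtoTransferGap
open Summit.QuantumFields.YangMills.Theorems.FemtoTransferGap.TT
open Summit.QuantumFields.YangMills.Theorems.VirialFluxGap.RingDeficit
open Summit.QuantumFields.YangMills.Theorems.VirialFluxGap.EulerFieldReduction (tail_le mean_le_of_virial)
open Summit.QuantumFields.YangMills.Theorems.VirialFluxGapPeriodicSoftnessWindow (stub_windowArithmeticZero)

variable {L : ℕ} [NeZero L]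

/-! ## §3 The reduction in tree gauge -/

/-- ★★★ **`PeriodicSoftness` from an Euler field on the REDUCED product group `X_fix` (tree gauge of slice `0`).**  An `L`-uniform Euler
field for the reduced deficit `F_fix(w,r) = F₀(glue w ∷ r)` — w3 g58's «EulerField» hypothesis verbatim on `X_fix` — implies the deciding crux
`VirialFluxGap.PeriodicSoftness` BY NAME (softness `c₁/2`, window of ✓`stub_windowArithmeticZero K q 1`).  No Euler field is constructed here.
[cite: Griffiths1964] [cite: SeilerLNP1982, §2] -/
theorem periodicSoftness_of_eulerFieldFix
    (hE : ∃ c₁ : ℝ, 0 < c₁ ∧ ∃ K : ℝ, 1 ≤ K ∧ ∃ q : ℝ, 0 ≤ q ∧ ∃ L₀ : ℕ, ∀ (L : ℕ) [NeZero L], L₀ ≤ L →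
      ∃ (n : ℕ) (γ : Fin n → ℝ → (OffIdx L → SU2) × ((Fin (2 * L - 1) → GaugeConfig 3 L SU2) × (Site 3 L → SU2)))
        (φ : Fin n → (OffIdx L → SU2) × ((Fin (2 * L - 1) → GaugeConfig 3 L SU2) × (Site 3 L → SU2)) → ℝ)
        (Dφ DF : Fin n → ℝ → (OffIdx L → SU2) × ((Fin (2 * L - 1) → GaugeConfig 3 L SU2) × (Site 3 L → SU2)) → ℝ)
        (E : (OffIdx L → SU2) × ((Fin (2 * L - 1) → GaugeConfig 3 L SU2) × (Site 3 L → SU2)) → ℝ) (ε ε₀ B : ℝ),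
        (∀ j, γ j 0 = 1) ∧ (∀ j, Measurable (φ j)) ∧ (∀ j x, |φ j x| ≤ B) ∧ 0 < ε₀ ∧
        (∀ j x, ∀ t ∈ Metric.ball (0 : ℝ) ε₀, HasDerivAt (fun s => φ j (x * γ j s)) (Dφ j t x) t) ∧
        (∀ j x, ∀ t ∈ Metric.ball (0 : ℝ) ε₀,
          HasDerivAt (fun s => ringDeficit L (fun _ => false)
            ((Fin.cons (glue (x * γ j s).1) (x * γ j s).2.1 : Fin (2 * L - 1 + 1) → GaugeConfig 3 L SU2), (x * γ j s).2.2))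
            (DF j t x) t) ∧
        (∀ j x, ∀ t ∈ Metric.ball (0 : ℝ) ε₀, |Dφ j t x| ≤ B) ∧ (∀ j x, ∀ t ∈ Metric.ball (0 : ℝ) ε₀, |DF j t x| ≤ B) ∧
        (∀ j, StronglyMeasurable (Dφ j 0)) ∧ (∀ j, StronglyMeasurable (DF j 0)) ∧
        Measurable E ∧ (∀ x, 0 ≤ E x) ∧ (∀ x, E x ≤ K * (L : ℝ) ^ q) ∧
        (∀ x, ringDeficit L (fun _ => false)
          ((Fin.cons (glue x.1) x.2.1 : Fin (2 * L - 1 + 1) → GaugeConfig 3 L SU2), x.2.2) < (K * (L : ℝ) ^ q)⁻¹ → E x = 0) ∧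
        0 ≤ ε ∧ ε ≤ 1 / 4 ∧ ε * (L : ℝ) ^ 4 ≤ c₁ / 72 ∧
        (∀ x, 2 * (1 - ε) * ringDeficit L (fun _ => false)
            ((Fin.cons (glue x.1) x.2.1 : Fin (2 * L - 1 + 1) → GaugeConfig 3 L SU2), x.2.2) - E x ≤ ∑ j, φ j x * DF j 0 x) ∧
        (∀ x, ∑ j, Dφ j 0 x ≤ 18 * (L : ℝ) ^ 4 - 2 * c₁)) :
    Summit.QuantumFields.YangMills.Theses.VirialFluxGap.PeriodicSoftness := by
  obtain ⟨c₁, hc₁, K, hK, q, hq, L₀, hfield⟩ := hE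
  have hK0 : 0 < K := by linarith
  obtain ⟨a, ha, β₀, hW⟩ := stub_windowArithmeticZero K q 1 hK0 hq one_pos le_rfl
  obtain ⟨L₁, hL₁⟩ : ∃ L₁ : ℕ, Real.log (4 / c₁) ≤ L₁ := exists_nat_ge _
  refine ⟨a, ha, c₁ / 2, by linarith, β₀, max L₀ L₁, fun β hβ L _ hL hLβ => ?_⟩
  have hL0 : L₀ ≤ L := le_trans (le_max_left _ _) hL
  have hLL₁ : L₁ ≤ L := le_trans (le_max_right _ _) hL
  have hL1 : 1 ≤ L := NeZero.one_le
  have hL1r : (1 : ℝ) ≤ L := by exact_mod_cast hL1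
  have hw : |(0 : ℝ)| ≤ K * (L : ℝ) ^ q := by rw [abs_zero]; positivity
  obtain ⟨hβ2, -, hthr, -⟩ := hW β hβ L hL1 hLβ 0 hw
  have hβ0 : 0 ≤ β := by linarith
  have hβpos : 0 < β := by linarith
  obtain ⟨n, γ, φ, Dφ, DF, E, ε, ε₀, B, hγ, hφm, hφb, hε₀, hDφ, hDF, hDφb, hDFb, hDφm, hDFm, hEm, hE0, hEle, hEsupp,
    hε0, hε4, hεL, hXF, hdiv⟩ := hfield L hL0
  set T : ℝ := K * (L : ℝ) ^ q with hT
  have hT1 : 1 ≤ T := by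
    have : (1 : ℝ) ≤ (L : ℝ) ^ q := Real.one_le_rpow hL1r hq
    nlinarith
  have hT0 : 0 < T := by linarith
  have ht₁ : 0 < T⁻¹ := inv_pos.2 hT0
  have ht₁2 : T⁻¹ ≤ 2 := by rw [inv_le_comm₀ hT0 (by norm_num)]; linarith
  have hEb : ∀ x, |E x| ≤ T := fun x => by rw [abs_of_nonneg (hE0 x)]; exact hEle x
  -- the β-explicit virial mean bound on `X_fix`
  have h1 := fix_virial_gibbsMean_le (L := L) (Finset.univ : Finset (Fin n)) (fun j _ => hγ j) (fun j _ => hφm j)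
    (Cφ := fun _ => B) (fun j _ x => hφb j x) hε₀ (fun j _ x t ht => hDφ j x t ht) (fun j _ x t ht => hDF j x t ht)
    (Bφ := fun _ => B) (BF := fun _ => B) (fun j _ x t ht => hDφb j x t ht) (fun j _ x t ht => hDFb j x t ht)
    (fun j _ => hDφm j) (fun j _ => hDFm j) hβ0 hEm hEb (D := 18 * (L : ℝ) ^ 4 - 2 * c₁) (by linarith : ε < 1) hXF hdiv
  have h2 := fix_gibbsMean_error_le (L := L) hβ0 ht₁ ht₁2 hT0.le hEle hEsupp
  have h3 : 0 < 2 * (1 - ε) := by linarith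
  have h4 : 18 * (L : ℝ) ^ 4 - 2 * c₁ + β * (∫ x, E x * Real.exp (-(β * ringDeficit L (fun _ => false)
          ((Fin.cons (glue x.1) x.2.1 : Fin (2 * L - 1 + 1) → GaugeConfig 3 L SU2), x.2.2)))
        ∂((Measure.pi fun _ : OffIdx L => haarProbability SU2).prod
          ((Measure.pi fun _ : Fin (2 * L - 1) => configMeasure SU2 L).prod (gaugeMeasure L)))) /
        (∫ x, Real.exp (-(β * ringDeficit L (fun _ => false)
            ((Fin.cons (glue x.1) x.2.1 : Fin (2 * L - 1 + 1) → GaugeConfig 3 L SU2), x.2.2)))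
          ∂((Measure.pi fun _ : OffIdx L => haarProbability SU2).prod
            ((Measure.pi fun _ : Fin (2 * L - 1) => configMeasure SU2 L).prod (gaugeMeasure L)))) ≤
      18 * (L : ℝ) ^ 4 - 2 * c₁ + β * (T * Real.exp (-(β * T⁻¹ / 2) + 150 * (L : ℝ) ^ 5 * (1 + Real.log (2 / T⁻¹)))) := by
    have h5 := mul_le_mul_of_nonneg_left h2 hβ0
    rw [mul_div_assoc]
    linarith
  have hvir := h1.trans (div_le_div_of_nonneg_right h4 h3.le)
  -- the tail
  have hlogL : Real.log (4 / c₁) ≤ (L : ℝ) ^ 8 := by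
    have h8 : (L : ℝ) ≤ (L : ℝ) ^ 8 := by
      calc (L : ℝ) = (L : ℝ) ^ 1 := (pow_one _).symm
        _ ≤ (L : ℝ) ^ 8 := pow_le_pow_right₀ hL1r (by norm_num)
    exact hL₁.trans ((Nat.cast_le.2 hLL₁).trans h8)
  have hthr' : 64 * (9 * (L : ℝ) ^ 4 - 3 / 2 + 2) ^ 2 * (1 + 2 * Real.log T + Real.log β) ≤ β * T⁻¹ := by
    have hlogT : |Real.log T⁻¹| = Real.log T := by
      rw [Real.log_inv, abs_neg, abs_of_nonneg (Real.log_nonneg hT1)]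
    have h := hthr
    rw [abs_zero, hlogT] at h
    linarith
  have htail := tail_le hβ2 hT1 hL1r hc₁ hlogL hthr'
  -- the mean bound on `X_fix`, transferred to `Ω`
  have hM0 : 0 ≤ β * (∫ p, ringDeficit L (fun _ => false) p * Real.exp (-(β * ringDeficit L (fun _ => false) p)) ∂(ringMeasure L)) /
      (∫ p, Real.exp (-(β * ringDeficit L (fun _ => false) p)) ∂(ringMeasure L)) := by
    refine div_nonneg (mul_nonneg hβ0 (integral_nonneg fun x => ?_)) (integral_exp_neg_mul_ringDeficit_pos (L := L) β _).le
    exact mul_nonneg (ringDeficit_nonneg _ x) (Real.exp_pos _).le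
  rw [← gibbsMean_eq_fix (L := L) hβ0] at hvir
  have hmean := mean_le_of_virial hM0 hε0 hε4 hεL htail hvir
  have hid := (deficitFormZero L).2.2 β hβpos
  rw [hid]
  linarith [hmean]

end Summit.QuantumFields.YangMills.Theorems.VirialFluxGap.TreeGaugeTransfer

end
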